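import Summits.CriticalPhenomena.PercolationContinuityZ3.Theorems.PercNearOneGluingNoHeavyLowerTailBlockQ9TwoDangerousPiece
import HarnessLib

/-!
# `NoHeavyLowerTail` (stmt-CriticalPhenomena-4575) — continuity of re-weighted percolation probabilities in the
# coins (tools for the topological step of the three-pair certificate for Kozma–Nitzan's Question 9)

Support file (hull-port / coupling seat `prim-hp-1` gen 12; `--supports stmt-CriticalPhenomena-4575`).
No definitions, no named facts, no sorries.  Memo `run/shared/lean/prim/prim-hp-1/HULLPORT-COUPLING.md` §52.

Every existence proof for the three-pair certificate (`BlockQ9.blockQ9_threeDangerous_of_tournament`) is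
topological (connectedness of `[0,1]` for the pointwise dichotomy; KKM on the hexagon of transitive tournaments in
general), and needs the validity of an anchored component to be a CONTINUOUS function of the coins.  This file:

* `BlockQ9.real_two_bond` — two-bond decomposition of `μ_u(Y)` along two distinct pairs;
* `BlockQ9.continuousOn_thin` — the odds-thinning map `x ↦ ρx/(1 − ρ + ρx)` is continuous on `[0,1]`;
* `BlockQ9.continuousOn_real_update_two` — if two pairs of a weight vector are re-weighted by `unitInterval`-valued
  functions of a parameter whose real values are continuous on `S`, the probability of any event is continuous on `S`
  (it is bilinear in the two weights, the four pinned measures being parameter-free).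
[cite: KozmaNitzan2024, Question 9 (p. 36)]
-/

namespace Summit.CriticalPhenomena.PercolationContinuityZ3.Theorems

open MeasureTheory Set
open Literature.Probability.LatticeModels
open Literature.Probability.Percolation

noncomputable section
open Classical

namespace BlockQ9

variable {n : ℕ}

/-- Two-bond decomposition of the probability of an event along two distinct pairs. [folklore] -/
theorem real_two_bond (u : Sym2 (Fin n) → unitInterval) (f g : Sym2 (Fin n)) (hgf : g ≠ f)
    (Y : Set (BondConfig (Fin n))) :
    (prodBernoulli u).real Y =
      (1 - (u f : ℝ)) * ((1 - (u g : ℝ)) * (prodBernoulli (Function.update (Function.update u f 0) g 0)).real Y +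
          (u g : ℝ) * (prodBernoulli (Function.update (Function.update u f 0) g 1)).real Y) +
        (u f : ℝ) * ((1 - (u g : ℝ)) * (prodBernoulli (Function.update (Function.update u f 1) g 0)).real Y +
          (u g : ℝ) * (prodBernoulli (Function.update (Function.update u f 1) g 1)).real Y) := by
  rw [stub_oneBondDecomp_k15 n u f Y, stub_oneBondDecomp_k15 n (Function.update u f 0) g Y,
    stub_oneBondDecomp_k15 n (Function.update u f 1) g Y, Function.update_of_ne hgf, Function.update_of_ne hgf]

/-- The odds-thinning map `x ↦ ρx/(1 − ρ + ρx)` is continuous on `[0,1]` when `0 ≤ ρ < 1`. [folklore] -/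
theorem continuousOn_thin {ρ : ℝ} (hρ0 : 0 ≤ ρ) (hρ : ρ < 1) :
    ContinuousOn (fun x : ℝ => ρ * x / (1 - ρ + ρ * x)) (Icc 0 1) := by
  apply ContinuousOn.div
  · exact (continuous_const.mul continuous_id).continuousOn
  · exact (continuous_const.add (continuous_const.mul continuous_id)).continuousOn
  · intro x hx
    have : 0 < 1 - ρ + ρ * x := by nlinarith [hx.1, hx.2]
    exact this.ne'

/-- **Continuity in the coins.**  Re-weighting two distinct pairs `f, g` of `u` by `unitInterval`-valued functions
`κ₁, κ₂` of a parameter whose real values are continuous on `S`: the probability of any event `Y` is continuous on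
`S`. [folklore] -/
theorem continuousOn_real_update_two {X : Type*} [TopologicalSpace X] (u : Sym2 (Fin n) → unitInterval)
    (f g : Sym2 (Fin n)) (hgf : g ≠ f) (κ₁ κ₂ : X → unitInterval) (S : Set X)
    (h₁ : ContinuousOn (fun x => ((κ₁ x : unitInterval) : ℝ)) S)
    (h₂ : ContinuousOn (fun x => ((κ₂ x : unitInterval) : ℝ)) S) (Y : Set (BondConfig (Fin n))) :
    ContinuousOn (fun x => (prodBernoulli (Function.update (Function.update u f (κ₁ x)) g (κ₂ x))).real Y) S := by
  -- the four pinned measures do not depend on the parameter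
  have pin : ∀ (x : X) (s s' : unitInterval),
      Function.update (Function.update (Function.update (Function.update u f (κ₁ x)) g (κ₂ x)) f s) g s' =
        Function.update (Function.update u f s) g s' := by
    intro x s s'
    funext e
    by_cases heg : e = g
    · subst heg; rw [Function.update_self, Function.update_self]
    · rw [Function.update_of_ne heg, Function.update_of_ne heg]
      by_cases hef : e = f
      · subst hef; rw [Function.update_self, Function.update_self]
      · rw [Function.update_of_ne hef, Function.update_of_ne hef, Function.update_of_ne heg,
          Function.update_of_ne hef]
  have vf : ∀ x, ((Function.update (Function.update u f (κ₁ x)) g (κ₂ x) f : unitInterval) : ℝ) = (κ₁ x : ℝ) := by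
    intro x; rw [Function.update_of_ne hgf.symm, Function.update_self]
  have vg : ∀ x, ((Function.update (Function.update u f (κ₁ x)) g (κ₂ x) g : unitInterval) : ℝ) = (κ₂ x : ℝ) := by
    intro x; rw [Function.update_self]
  have key : (fun x => (prodBernoulli (Function.update (Function.update u f (κ₁ x)) g (κ₂ x))).real Y) = fun x =>
      (1 - (κ₁ x : ℝ)) * ((1 - (κ₂ x : ℝ)) * (prodBernoulli (Function.update (Function.update u f 0) g 0)).real Y +
          (κ₂ x : ℝ) * (prodBernoulli (Function.update (Function.update u f 0) g 1)).real Y) +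
        (κ₁ x : ℝ) * ((1 - (κ₂ x : ℝ)) * (prodBernoulli (Function.update (Function.update u f 1) g 0)).real Y +
          (κ₂ x : ℝ) * (prodBernoulli (Function.update (Function.update u f 1) g 1)).real Y) := by
    funext x
    rw [real_two_bond _ f g hgf Y, vf, vg, pin, pin, pin, pin]
  rw [key]
  apply ContinuousOn.add
  · exact (continuousOn_const.sub h₁).mul
      (((continuousOn_const.sub h₂).mul continuousOn_const).add (h₂.mul continuousOn_const))
  · exact h₁.mul (((continuousOn_const.sub h₂).mul continuousOn_const).add (h₂.mul continuousOn_const))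

end BlockQ9

end

end Summit.CriticalPhenomena.PercolationContinuityZ3.Theorems
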